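import Literature.MathematicalPhysics.QuantumLattice.ApproximateEigenvectorLemmas
import HarnessLib

/-!
# Ground-state enclosure from a residual and a gap on a trial subspace

The elementary "last mile" of every exact-diagonalisation CERTIFICATE for a ground state: a
Hermitian matrix `H` on `n → ℂ`, a normalised eigenvector `ψ` with eigenvalue `E` (the ground
state one wants to control), a normalised TRIAL vector `y`, and a subspace `W ∋ ψ, y` (in practice the
fixed space of a symmetry group, where the certificate lives). If the quadratic form of `H` is
bounded below by `θ > E` on `W ∩ y^⊥` (a finite, checkable statement: positivity of
`H - θ + α |y⟩⟨y|` on `W`) then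

* `re_form_ge_of_orthogonal_eigenvector` — the same lower bound `θ` holds on `W ∩ ψ^⊥` (a
  two-dimensional argument: on `span{ψ, χ}` the form `⟨·,(H-θ)·⟩` would be negative definite, but
  this plane meets `y^⊥`); no spectral theorem is used;
* `eucNorm_sub_proj_le_of_residual` — DAVIS–KAHAN for the lowest eigenvector: for every `ρ < θ`,
  `‖y - ⟨ψ,y⟩ψ‖₂ ≤ ‖(H - ρ)y‖₂ / (θ - ρ)` (the component of `y` orthogonal to `ψ` is controlled by
  the residual and the gap);
* `norm_expect_sub_expect_le` — expectations in `y` and in `ψ` differ by at most `a(2δ + 2δ²)` for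
  an observable with `‖A v‖₂ ≤ a‖v‖₂` when `‖y - ⟨ψ,y⟩ψ‖₂ ≤ δ`, `‖ψ‖₂ = ‖y‖₂ = 1`;
* `norm_expect_sub_expect_le_of_certificate` — the two combined: residual `≤ ε`, gap `θ` on
  `W ∩ y^⊥`, `ρ < θ`, `E < θ` give `|⟨y,Ay⟩ - ⟨ψ,Aψ⟩| ≤ a(2δ + 2δ²)` with `δ = ε/(θ - ρ)`.

These are the textbook residual/gap bounds (Davis–Kahan `sin Θ` theorem for an isolated lowest
eigenvalue; Parlett, *The Symmetric Eigenvalue Problem* (1998) Thm. 11.7.1; Kato (1949)) in the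
coordinate vocabulary of `ApproximateEigenvectorLemmas.lean` (`eucNorm`, `mulVec`, `star _ ⬝ᵥ _`).
No definition is introduced; sorry-free.
-/

noncomputable section

open Matrix Complex Finset
open scoped ComplexOrder ComplexConjugate

namespace Literature.MathematicalPhysics.QuantumLattice

variable {n : Type*} [Fintype n]

/-! ### Algebra of a Hermitian matrix against one of its eigenvectors -/

/-- For Hermitian `H` with `H ψ = E ψ` (`E` real): `⟨ψ, H χ⟩ = E ⟨ψ, χ⟩` for every `χ`. [folklore] -/
theorem star_dotProduct_mulVec_of_eigenvector {H : Matrix n n ℂ} (hH : H.IsHermitian)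
    {ψ : n → ℂ} {E : ℝ} (hHψ : H *ᵥ ψ = (E : ℂ) • ψ) (χ : n → ℂ) :
    star ψ ⬝ᵥ (H *ᵥ χ) = (E : ℂ) * (star ψ ⬝ᵥ χ) := by
  have h1 : star ψ ⬝ᵥ (H *ᵥ χ) = star (Hᴴ *ᵥ ψ) ⬝ᵥ χ := by
    rw [dotProduct_mulVec, star_mulVec, conjTranspose_conjTranspose]
  rw [h1, hH.eq, hHψ, star_smul, smul_dotProduct, smul_eq_mul, Complex.star_def,
    Complex.conj_ofReal]

/-- For Hermitian `H` with `H ψ = E ψ` and `χ ⊥ ψ`: `⟨ψ, H χ⟩ = 0` and `⟨χ, H ψ⟩ = 0`. [folklore] -/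
theorem cross_terms_eq_zero_of_eigenvector {H : Matrix n n ℂ} (hH : H.IsHermitian)
    {ψ χ : n → ℂ} {E : ℝ} (hHψ : H *ᵥ ψ = (E : ℂ) • ψ) (hχψ : star ψ ⬝ᵥ χ = 0) :
    star ψ ⬝ᵥ (H *ᵥ χ) = 0 ∧ star χ ⬝ᵥ (H *ᵥ ψ) = 0 := by
  refine ⟨by rw [star_dotProduct_mulVec_of_eigenvector hH hHψ, hχψ, mul_zero], ?_⟩
  have h : star χ ⬝ᵥ ψ = 0 := by
    rw [star_dotProduct, hχψ, star_zero]
  rw [hHψ, dotProduct_smul, h, smul_zero]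

/-- `Re (conj c * c * z) = ‖c‖² Re z`. [folklore] -/
theorem re_conj_mul_mul (c z : ℂ) : ((starRingEnd ℂ) c * c * z).re = ‖c‖ ^ 2 * z.re := by
  rw [Complex.conj_mul', ← Complex.ofReal_pow, Complex.re_ofReal_mul]

/-! ### The gap transfers from `y^⊥` to `ψ^⊥` -/

/-- **The gap transfers from the trial vector to the eigenvector.** Let `H` be Hermitian,
`H ψ = E ψ` with `ψ ≠ 0` and `E < θ`, and let `W` be a subspace containing `ψ` and `y` on which
`θ ‖φ‖² ≤ Re⟨φ, H φ⟩` for all `φ ∈ W` orthogonal to `y`. Then `θ ‖χ‖² ≤ Re⟨χ, H χ⟩` for every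
`χ ∈ W` orthogonal to `ψ`. Proof: otherwise the form `⟨·,(H - θ)·⟩` is negative definite on
`span{ψ, χ}` (the cross terms vanish because `ψ` is an eigenvector and `χ ⊥ ψ`), but this plane
contains the nonzero vector `⟨y,χ⟩ψ - ⟨y,ψ⟩χ ⊥ y` (or `ψ ⊥ y` itself). [folklore] -/
theorem re_form_ge_of_orthogonal_eigenvector {H : Matrix n n ℂ} (hH : H.IsHermitian)
    {W : Submodule ℂ (n → ℂ)} {ψ y : n → ℂ} (hψW : ψ ∈ W) (hψ0 : ψ ≠ 0)
    {E θ : ℝ} (hHψ : H *ᵥ ψ = (E : ℂ) • ψ) (hE : E < θ)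
    (hgap : ∀ φ ∈ W, star y ⬝ᵥ φ = 0 → θ * (star φ ⬝ᵥ φ).re ≤ (star φ ⬝ᵥ (H *ᵥ φ)).re)
    {χ : n → ℂ} (hχW : χ ∈ W) (hχψ : star ψ ⬝ᵥ χ = 0) :
    θ * (star χ ⬝ᵥ χ).re ≤ (star χ ⬝ᵥ (H *ᵥ χ)).re := by
  by_contra hneg
  push Not at hneg
  -- norms and the eigen-expectation
  have hψψ : 0 < (star ψ ⬝ᵥ ψ).re := by
    have h := dotProduct_star_self_pos_iff.mpr hψ0
    exact (Complex.pos_iff.mp h).1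
  have hψH : (star ψ ⬝ᵥ (H *ᵥ ψ)).re = E * (star ψ ⬝ᵥ ψ).re := by
    rw [star_dotProduct_mulVec_of_eigenvector hH hHψ, Complex.re_ofReal_mul]
  obtain ⟨hc1, hc2⟩ := cross_terms_eq_zero_of_eigenvector hH hHψ hχψ
  have hχψ' : star χ ⬝ᵥ ψ = 0 := by rw [star_dotProduct, hχψ, star_zero]
  -- the quadratic form on `a ψ + b χ`
  have hform : ∀ a b : ℂ,
      (star (a • ψ + b • χ) ⬝ᵥ (H *ᵥ (a • ψ + b • χ))).re -
          θ * (star (a • ψ + b • χ) ⬝ᵥ (a • ψ + b • χ)).re =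
        ‖a‖ ^ 2 * ((E - θ) * (star ψ ⬝ᵥ ψ).re) +
          ‖b‖ ^ 2 * ((star χ ⬝ᵥ (H *ᵥ χ)).re - θ * (star χ ⬝ᵥ χ).re) := by
    intro a b
    have e1 : star (a • ψ + b • χ) ⬝ᵥ (H *ᵥ (a • ψ + b • χ)) =
        (starRingEnd ℂ) a * a * (star ψ ⬝ᵥ (H *ᵥ ψ)) +
          (starRingEnd ℂ) b * b * (star χ ⬝ᵥ (H *ᵥ χ)) := by
      simp only [mulVec_add, mulVec_smul, star_add, star_smul, add_dotProduct, smul_dotProduct,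
        dotProduct_add, dotProduct_smul, hc1, hc2, smul_eq_mul, mul_zero, add_zero, zero_add,
        Complex.star_def]
      ring
    have e2 : star (a • ψ + b • χ) ⬝ᵥ (a • ψ + b • χ) =
        (starRingEnd ℂ) a * a * (star ψ ⬝ᵥ ψ) + (starRingEnd ℂ) b * b * (star χ ⬝ᵥ χ) := by
      simp only [star_add, star_smul, add_dotProduct, smul_dotProduct, dotProduct_add,
        dotProduct_smul, hχψ, hχψ', smul_eq_mul, mul_zero, add_zero, zero_add, Complex.star_def]
      ring
    rw [e1, e2, Complex.add_re, Complex.add_re, re_conj_mul_mul, re_conj_mul_mul, re_conj_mul_mul,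
      re_conj_mul_mul, hψH]
    ring
  have hqψ : (E - θ) * (star ψ ⬝ᵥ ψ).re < 0 := mul_neg_of_neg_of_pos (by linarith) hψψ
  have hqχ : (star χ ⬝ᵥ (H *ᵥ χ)).re - θ * (star χ ⬝ᵥ χ).re < 0 := by linarith
  -- the vector of the plane orthogonal to `y`
  set a : ℂ := star y ⬝ᵥ χ with ha
  set b : ℂ := -(star y ⬝ᵥ ψ) with hb
  by_cases hab : a = 0 ∧ b = 0
  · -- then `ψ ⊥ y`, and the gap hypothesis applied to `ψ` contradicts `E < θ`
    have hyψ : star y ⬝ᵥ ψ = 0 := by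
      have := hab.2; rw [hb, neg_eq_zero] at this; exact this
    have h := hgap ψ hψW hyψ
    rw [hψH] at h
    nlinarith
  · set φ : n → ℂ := a • ψ + b • χ with hφ
    have hφW : φ ∈ W := W.add_mem (W.smul_mem a hψW) (W.smul_mem b hχW)
    have hφy : star y ⬝ᵥ φ = 0 := by
      rw [hφ, dotProduct_add, dotProduct_smul, dotProduct_smul, smul_eq_mul, smul_eq_mul, ← ha,
        hb]
      ring
    have h := hgap φ hφW hφy
    have h2 := hform a b
    rw [← hφ] at h2
    -- `‖a‖² q(ψ) + ‖b‖² q(χ) < 0`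
    have hlt : ‖a‖ ^ 2 * ((E - θ) * (star ψ ⬝ᵥ ψ).re) +
        ‖b‖ ^ 2 * ((star χ ⬝ᵥ (H *ᵥ χ)).re - θ * (star χ ⬝ᵥ χ).re) < 0 := by
      rcases not_and_or.mp hab with ha0 | hb0
      · have : 0 < ‖a‖ ^ 2 := by positivity
        nlinarith [sq_nonneg ‖b‖]
      · have : 0 < ‖b‖ ^ 2 := by positivity
        nlinarith [sq_nonneg ‖a‖]
    linarith

/-! ### Davis–Kahan for the lowest eigenvector -/

/-- Pythagoras for orthogonal coordinate vectors: `‖u + v‖₂² = ‖u‖₂² + ‖v‖₂²` if `⟨u, v⟩ = 0`.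
[folklore] -/
theorem eucNorm_sq_add_of_orthogonal {u v : n → ℂ} (huv : star u ⬝ᵥ v = 0) :
    eucNorm (u + v) ^ 2 = eucNorm u ^ 2 + eucNorm v ^ 2 := by
  have hvu : star v ⬝ᵥ u = 0 := by rw [star_dotProduct, huv, star_zero]
  rw [eucNorm_sq, eucNorm_sq, eucNorm_sq, star_add, add_dotProduct, dotProduct_add, dotProduct_add,
    huv, hvu]
  simp

/-- `Re ⟨χ, v⟩ ≤ ‖χ‖₂ ‖v‖₂`. [folklore] -/
theorem re_star_dotProduct_le (χ v : n → ℂ) : (star χ ⬝ᵥ v).re ≤ eucNorm χ * eucNorm v :=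
  (Complex.re_le_norm _).trans (norm_star_dotProduct_le χ v)

/-- **Davis–Kahan for the lowest eigenvector (residual/gap bound).** Let `H` be Hermitian,
`H ψ = E ψ` with `‖ψ‖₂ = 1`, `E < θ`, and let `W ∋ ψ, y` be a subspace with
`θ ‖φ‖² ≤ Re⟨φ, H φ⟩` for all `φ ∈ W ∩ y^⊥`. Then for every `ρ < θ` the component of `y`
orthogonal to `ψ` is bounded by the residual: `‖y - ⟨ψ,y⟩ψ‖₂ ≤ ‖H y - ρ y‖₂ / (θ - ρ)`.
Proof: `χ = y - ⟨ψ,y⟩ψ ∈ W ∩ ψ^⊥`, so `(θ - ρ)‖χ‖² ≤ Re⟨χ,(H - ρ)χ⟩ ≤ ‖χ‖ ‖(H - ρ)χ‖`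
(`re_form_ge_of_orthogonal_eigenvector`), and `(H - ρ)y = ⟨ψ,y⟩(E - ρ)ψ + (H - ρ)χ` is an
orthogonal decomposition, whence `‖(H - ρ)χ‖ ≤ ‖(H - ρ)y‖`. (Parlett (1998) Thm. 11.7.1;
Davis–Kahan (1970).) [folklore] -/
theorem eucNorm_sub_proj_le_of_residual {H : Matrix n n ℂ} (hH : H.IsHermitian)
    {W : Submodule ℂ (n → ℂ)} {ψ y : n → ℂ} (hψW : ψ ∈ W) (hyW : y ∈ W)
    (hψ1 : star ψ ⬝ᵥ ψ = 1) {E θ ρ : ℝ} (hHψ : H *ᵥ ψ = (E : ℂ) • ψ) (hE : E < θ) (hρ : ρ < θ)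
    (hgap : ∀ φ ∈ W, star y ⬝ᵥ φ = 0 → θ * (star φ ⬝ᵥ φ).re ≤ (star φ ⬝ᵥ (H *ᵥ φ)).re) :
    eucNorm (y - (star ψ ⬝ᵥ y) • ψ) ≤ eucNorm (H *ᵥ y - (ρ : ℂ) • y) / (θ - ρ) := by
  have hψ0 : ψ ≠ 0 := by
    rintro rfl; rw [star_zero, zero_dotProduct] at hψ1; exact zero_ne_one hψ1
  set c : ℂ := star ψ ⬝ᵥ y with hc
  set χ : n → ℂ := y - c • ψ with hχ
  have hχW : χ ∈ W := W.sub_mem hyW (W.smul_mem c hψW)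
  have hχψ : star ψ ⬝ᵥ χ = 0 := by
    rw [hχ, dotProduct_sub, dotProduct_smul, hψ1, smul_eq_mul, mul_one, hc, sub_self]
  -- (1) the gap on `χ`
  have hgapχ := re_form_ge_of_orthogonal_eigenvector hH hψW hψ0 hHψ hE hgap hχW hχψ
  -- (2) `(θ - ρ)‖χ‖² ≤ ‖χ‖ ‖(H - ρ)χ‖`
  have hRe : (star χ ⬝ᵥ (H *ᵥ χ - (ρ : ℂ) • χ)).re =
      (star χ ⬝ᵥ (H *ᵥ χ)).re - ρ * (star χ ⬝ᵥ χ).re := by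
    rw [dotProduct_sub, dotProduct_smul, Complex.sub_re, smul_eq_mul, Complex.re_ofReal_mul]
  have hχsq : (star χ ⬝ᵥ χ).re = eucNorm χ ^ 2 := (eucNorm_sq χ).symm
  have h2 : (θ - ρ) * eucNorm χ ^ 2 ≤ eucNorm χ * eucNorm (H *ᵥ χ - (ρ : ℂ) • χ) := by
    have h := re_star_dotProduct_le χ (H *ᵥ χ - (ρ : ℂ) • χ)
    rw [hRe] at h
    rw [← hχsq]
    nlinarith [hgapχ]
  -- (3) `‖(H - ρ)χ‖ ≤ ‖(H - ρ)y‖` by the orthogonal decomposition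
  have hdec : H *ᵥ y - (ρ : ℂ) • y = (c * ((E : ℂ) - ρ)) • ψ + (H *ᵥ χ - (ρ : ℂ) • χ) := by
    have hy : y = c • ψ + χ := by rw [hχ, add_sub_cancel]
    conv_lhs => rw [hy]
    rw [mulVec_add, mulVec_smul, hHψ, smul_add, smul_smul, smul_smul, mul_sub, mul_comm c (ρ : ℂ),
      sub_smul]
    abel
  have horth : star ((c * ((E : ℂ) - ρ)) • ψ) ⬝ᵥ (H *ᵥ χ - (ρ : ℂ) • χ) = 0 := by
    rw [star_smul, smul_dotProduct, dotProduct_sub, dotProduct_smul,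
      (cross_terms_eq_zero_of_eigenvector hH hHψ hχψ).1, hχψ, smul_zero, sub_zero, smul_zero]
  have h3 : eucNorm (H *ᵥ χ - (ρ : ℂ) • χ) ≤ eucNorm (H *ᵥ y - (ρ : ℂ) • y) := by
    have hsq := eucNorm_sq_add_of_orthogonal horth
    rw [← hdec] at hsq
    have h0 : 0 ≤ eucNorm ((c * ((E : ℂ) - ρ)) • ψ) ^ 2 := sq_nonneg _
    exact (pow_le_pow_iff_left₀ (eucNorm_nonneg _) (eucNorm_nonneg _) two_ne_zero).mp
      (by nlinarith)
  -- (4) conclude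
  have hθρ : 0 < θ - ρ := by linarith
  rw [le_div_iff₀ hθρ]
  have hχ0 := eucNorm_nonneg χ
  by_cases hz : eucNorm χ = 0
  · rw [hz, zero_mul]; exact eucNorm_nonneg _
  · have hpos : 0 < eucNorm χ := lt_of_le_of_ne hχ0 (Ne.symm hz)
    have h4 : (θ - ρ) * eucNorm χ ≤ eucNorm (H *ᵥ χ - (ρ : ℂ) • χ) := by
      have := h2
      nlinarith
    calc eucNorm χ * (θ - ρ) = (θ - ρ) * eucNorm χ := mul_comm _ _
      _ ≤ eucNorm (H *ᵥ χ - (ρ : ℂ) • χ) := h4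
      _ ≤ eucNorm (H *ᵥ y - (ρ : ℂ) • y) := h3

/-! ### From vector enclosure to expectation enclosure -/

/-- **Expectations of a trial vector and of the eigenvector it encloses.** For unit vectors
`ψ, y` with `‖y - ⟨ψ,y⟩ψ‖₂ ≤ δ` and an observable `A` with `‖A v‖₂ ≤ a ‖v‖₂`:
`|⟨y, A y⟩ - ⟨ψ, A ψ⟩| ≤ a (2δ + 2δ²)`. (Write `y = cψ + χ`, `|c|² = 1 - ‖χ‖²`, expand, and bound
the four terms by Cauchy–Schwarz.) [folklore] -/
theorem norm_expect_sub_expect_le {ψ y : n → ℂ} (hψ1 : star ψ ⬝ᵥ ψ = 1) (hy1 : star y ⬝ᵥ y = 1)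
    {δ : ℝ} (hδ : eucNorm (y - (star ψ ⬝ᵥ y) • ψ) ≤ δ) (A : Matrix n n ℂ) {a : ℝ}
    (hA : ∀ v, eucNorm (A *ᵥ v) ≤ a * eucNorm v) :
    ‖star y ⬝ᵥ (A *ᵥ y) - star ψ ⬝ᵥ (A *ᵥ ψ)‖ ≤ a * (2 * δ + 2 * δ ^ 2) := by
  set c : ℂ := star ψ ⬝ᵥ y with hc
  set χ : n → ℂ := y - c • ψ with hχ
  have hχψ : star ψ ⬝ᵥ χ = 0 := by
    rw [hχ, dotProduct_sub, dotProduct_smul, hψ1, smul_eq_mul, mul_one, hc, sub_self]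
  have hχψ' : star χ ⬝ᵥ ψ = 0 := by rw [star_dotProduct, hχψ, star_zero]
  have hy : y = c • ψ + χ := by rw [hχ, add_sub_cancel]
  have hψn : eucNorm ψ = 1 := eucNorm_eq_one hψ1
  have ha : 0 ≤ a := by
    have h := hA ψ
    rw [hψn, mul_one] at h
    exact (eucNorm_nonneg _).trans h
  have hχn : eucNorm χ ≤ δ := hδ
  have hχ0 : 0 ≤ eucNorm χ := eucNorm_nonneg χ
  -- `|c|² + ‖χ‖² = 1`
  have hcχ : ‖c‖ ^ 2 + eucNorm χ ^ 2 = 1 := by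
    have hsq := eucNorm_sq_add_of_orthogonal (u := c • ψ) (v := χ)
      (by rw [star_smul, smul_dotProduct, hχψ, smul_zero])
    rw [← hy, eucNorm_eq_one hy1, eucNorm_smul, hψn, mul_one, one_pow] at hsq
    linarith
  have hc1 : ‖c‖ ≤ 1 := by nlinarith [norm_nonneg c, sq_nonneg (eucNorm χ)]
  -- expand `⟨y, A y⟩`
  have hexp : star y ⬝ᵥ (A *ᵥ y) - star ψ ⬝ᵥ (A *ᵥ ψ) =
      ((starRingEnd ℂ) c * c - 1) * (star ψ ⬝ᵥ (A *ᵥ ψ)) + (starRingEnd ℂ) c * (star ψ ⬝ᵥ (A *ᵥ χ)) +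
        c * (star χ ⬝ᵥ (A *ᵥ ψ)) + star χ ⬝ᵥ (A *ᵥ χ) := by
    conv_lhs => rw [hy]
    simp only [mulVec_add, mulVec_smul, star_add, star_smul, add_dotProduct, smul_dotProduct,
      dotProduct_add, dotProduct_smul, smul_eq_mul, Complex.star_def]
    ring
  have hcc : (starRingEnd ℂ) c * c - 1 = -((eucNorm χ ^ 2 : ℝ) : ℂ) := by
    rw [Complex.conj_mul']
    have : ((‖c‖ ^ 2 : ℝ) : ℂ) = 1 - ((eucNorm χ ^ 2 : ℝ) : ℂ) := by
      rw [← Complex.ofReal_one, ← Complex.ofReal_sub]; congr 1; linarith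
    rw [← Complex.ofReal_pow, this]; ring
  -- the four bounds
  have b1 : ‖star ψ ⬝ᵥ (A *ᵥ ψ)‖ ≤ a := by
    have h := norm_star_dotProduct_le_eucNorm hψ1 (A *ᵥ ψ)
    have h' := hA ψ
    rw [hψn, mul_one] at h'
    exact h.trans h'
  have b2 : ‖star ψ ⬝ᵥ (A *ᵥ χ)‖ ≤ a * eucNorm χ :=
    (norm_star_dotProduct_le_eucNorm hψ1 (A *ᵥ χ)).trans (hA χ)
  have b3 : ‖star χ ⬝ᵥ (A *ᵥ ψ)‖ ≤ eucNorm χ * a := by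
    have h := norm_star_dotProduct_le χ (A *ᵥ ψ)
    have h' := hA ψ
    rw [hψn, mul_one] at h'
    exact h.trans (mul_le_mul_of_nonneg_left h' hχ0)
  have b4 : ‖star χ ⬝ᵥ (A *ᵥ χ)‖ ≤ eucNorm χ * (a * eucNorm χ) :=
    (norm_star_dotProduct_le χ (A *ᵥ χ)).trans (mul_le_mul_of_nonneg_left (hA χ) hχ0)
  rw [hexp, hcc]
  have hn1 : ‖-((eucNorm χ ^ 2 : ℝ) : ℂ) * (star ψ ⬝ᵥ (A *ᵥ ψ))‖ ≤ eucNorm χ ^ 2 * a := by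
    rw [norm_mul, norm_neg, Complex.norm_real, Real.norm_eq_abs, abs_of_nonneg (sq_nonneg _)]
    exact mul_le_mul_of_nonneg_left b1 (sq_nonneg _)
  have hn2 : ‖(starRingEnd ℂ) c * (star ψ ⬝ᵥ (A *ᵥ χ))‖ ≤ a * eucNorm χ := by
    rw [norm_mul, Complex.norm_conj]
    calc ‖c‖ * ‖star ψ ⬝ᵥ (A *ᵥ χ)‖ ≤ 1 * (a * eucNorm χ) :=
          mul_le_mul hc1 b2 (norm_nonneg _) zero_le_one
      _ = a * eucNorm χ := one_mul _
  have hn3 : ‖c * (star χ ⬝ᵥ (A *ᵥ ψ))‖ ≤ eucNorm χ * a := by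
    rw [norm_mul]
    calc ‖c‖ * ‖star χ ⬝ᵥ (A *ᵥ ψ)‖ ≤ 1 * (eucNorm χ * a) :=
          mul_le_mul hc1 b3 (norm_nonneg _) zero_le_one
      _ = eucNorm χ * a := one_mul _
  calc ‖-((eucNorm χ ^ 2 : ℝ) : ℂ) * (star ψ ⬝ᵥ (A *ᵥ ψ)) + (starRingEnd ℂ) c * (star ψ ⬝ᵥ (A *ᵥ χ)) +
          c * (star χ ⬝ᵥ (A *ᵥ ψ)) + star χ ⬝ᵥ (A *ᵥ χ)‖
      ≤ ‖-((eucNorm χ ^ 2 : ℝ) : ℂ) * (star ψ ⬝ᵥ (A *ᵥ ψ))‖ + ‖(starRingEnd ℂ) c * (star ψ ⬝ᵥ (A *ᵥ χ))‖ +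
          ‖c * (star χ ⬝ᵥ (A *ᵥ ψ))‖ + ‖star χ ⬝ᵥ (A *ᵥ χ)‖ := by
        refine (norm_add_le _ _).trans (add_le_add ((norm_add_le _ _).trans
          (add_le_add (norm_add_le _ _) le_rfl)) le_rfl)
    _ ≤ eucNorm χ ^ 2 * a + a * eucNorm χ + eucNorm χ * a + eucNorm χ * (a * eucNorm χ) := by
        linarith [hn1, hn2, hn3, b4]
    _ = a * (2 * eucNorm χ + 2 * eucNorm χ ^ 2) := by ring
    _ ≤ a * (2 * δ + 2 * δ ^ 2) := by
        refine mul_le_mul_of_nonneg_left ?_ ha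
        nlinarith

/-- **Ground-state expectation enclosure from a certificate** (`eucNorm_sub_proj_le_of_residual` +
`norm_expect_sub_expect_le`). Let `H` be Hermitian, `H ψ = E ψ`, `‖ψ‖₂ = ‖y‖₂ = 1`, `W ∋ ψ, y` a
subspace with the form bound `θ ‖φ‖² ≤ Re⟨φ, H φ⟩` on `W ∩ y^⊥`, `E < θ`, `ρ < θ`, residual
`‖H y - ρ y‖₂ ≤ ε`, and `A` an observable with `‖A v‖₂ ≤ a‖v‖₂`. Then
`|⟨y, A y⟩ - ⟨ψ, A ψ⟩| ≤ a (2δ + 2δ²)` with `δ = ε / (θ - ρ)`. This is what an exact-arithmetic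
certificate (trial vector, residual, positivity of `H - θ + α|y⟩⟨y|` on the symmetric subspace)
feeds to conclude bounds on ground-state correlations. [folklore] -/
theorem norm_expect_sub_expect_le_of_certificate {H : Matrix n n ℂ} (hH : H.IsHermitian)
    {W : Submodule ℂ (n → ℂ)} {ψ y : n → ℂ} (hψW : ψ ∈ W) (hyW : y ∈ W)
    (hψ1 : star ψ ⬝ᵥ ψ = 1) (hy1 : star y ⬝ᵥ y = 1) {E θ ρ ε : ℝ}
    (hHψ : H *ᵥ ψ = (E : ℂ) • ψ) (hE : E < θ) (hρ : ρ < θ)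
    (hgap : ∀ φ ∈ W, star y ⬝ᵥ φ = 0 → θ * (star φ ⬝ᵥ φ).re ≤ (star φ ⬝ᵥ (H *ᵥ φ)).re)
    (hres : eucNorm (H *ᵥ y - (ρ : ℂ) • y) ≤ ε) (A : Matrix n n ℂ) {a : ℝ}
    (hA : ∀ v, eucNorm (A *ᵥ v) ≤ a * eucNorm v) :
    ‖star y ⬝ᵥ (A *ᵥ y) - star ψ ⬝ᵥ (A *ᵥ ψ)‖ ≤
      a * (2 * (ε / (θ - ρ)) + 2 * (ε / (θ - ρ)) ^ 2) := by
  have hδ := eucNorm_sub_proj_le_of_residual hH hψW hyW hψ1 hHψ hE hρ hgap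
  have hθρ : 0 < θ - ρ := by linarith
  have hδ' : eucNorm (y - (star ψ ⬝ᵥ y) • ψ) ≤ ε / (θ - ρ) :=
    hδ.trans (div_le_div_of_nonneg_right hres hθρ.le)
  exact norm_expect_sub_expect_le hψ1 hy1 hδ' A hA

end Literature.MathematicalPhysics.QuantumLattice

end
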